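import Literature.Algebra.Homology.OrderedCechSystemCupAssoc
import HarnessLib

/-!
# The ordered Čech cup product, IV: units of a system of algebras and graded commutativity in bidegree `(1,1)`
# (Godement, *Topologie algébrique et théorie des faisceaux*, II §6.6; Görtz–Wedhorn II (21.29); Stacks 01FP)

Sequel to `Algebra/Homology/OrderedCechSystemCup` (`cup β p q n`, the front-face/back-face cup product of ordered Čech
cochains of systems of `A`-modules along a pairing `β`, vertex-free form
`(f ∪ g)_σ = Σ_{v ∈ σ} β_σ (f.ext0At σ_{≤v} σ) (g.ext0At σ_{≥v} σ)`) and `…CupLeibniz` (the Leibniz rule).  THEOREMS ONLY: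

(associativity is `Algebra/Homology/OrderedCechSystemCupAssoc`)
* For a system with a natural, unital multiplication `μ : M × M → M` (a system of ALGEBRAS, given by hypotheses — no new
  structure): the unit `0`-cochain `1 = (1_s)_s` is a cocycle (`sysD_unit_eq_zero`), and `1 ∪ f = f = f ∪ 1`
  (`unit_cup`, `cup_unit`);
* **`cup_add_cup_swap_eq_neg_sysD` (graded commutativity in bidegree `(1,1)`):** for a COMMUTATIVE natural pairing and two
  `1`-COCYCLES `a`, `b`: `a ∪ b + b ∪ a = − d(a ⋆ b)` with `(a ⋆ b)_e = μ(a_e, b_e)` the pointwise product — so on cohomology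
  `[a] ∪ [b] = −[b] ∪ [a]` ([Godement1958, II §6.6]; the general graded commutativity needs more and is not in this file).

Everything here is proved; no definitions, no named facts.  Library only (cell hodgecm-mathlib, FLOOR-0 P1 F-11 road A,
jobs J3/J4-(iv)); HC_CM is proved only modulo the 7 printed citations until rung 0 closes, and nothing here bears on it.

## References

* [Godement1958] R. Godement, *Topologie algébrique et théorie des faisceaux*, Hermann (1958), II §6.6.
* [GortzWedhorn2023] U. Görtz, T. Wedhorn, *Algebraic Geometry II: Cohomology of Schemes* (2023), Def. 21.68, (21.29).
* [StacksProject] The Stacks Project, Tag 01FP.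
-/

universe v u

open CategoryTheory

set_option backward.isDefEq.respectTransparency false

noncomputable section

namespace Literature.Algebra.Homology

namespace OrderedCech

variable {ι : Type} [LinearOrder ι]

/-! ### Units: a system of algebras -/

section Unit

variable {A : Type u} [CommRing A] {M N : Finset ι ⥤ ModuleCat.{v} A}

/-- **The unit `0`-cochain is a cocycle**: for a family `u_s ∈ M s` compatible with the restriction maps
(`(u_s)|_t = u_t`), the `0`-cochain `σ ↦ u_σ` has `d u = 0`. [cite: Godement1958, II §6.6] -/
theorem sysD_unit_eq_zero (u : ∀ s : Finset ι, M.obj s)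
    (hu : ∀ ⦃s t : Finset ι⦄ (h : s ⊆ t), (M.map (homOfLE h)).hom (u s) = u t) :
    sysD M 0 (fun σ => u σ.1) = 0 := by
  rw [sysD_zero_eq_zero_iff]
  intro a b hab
  exact (hu _).trans (hu _).symm

/-- **Left unit**: for a pairing `β : M × N → N` with `β_s(u_s, y) = y` and a compatible family `u`:
`u ∪ g = g` on cochains. [cite: Godement1958, II §6.6] -/
theorem unit_cup {β : ∀ s : Finset ι, M.obj s →ₗ[A] N.obj s →ₗ[A] N.obj s} (u : ∀ s : Finset ι, M.obj s)
    (hu : ∀ ⦃s t : Finset ι⦄ (h : s ⊆ t), (M.map (homOfLE h)).hom (u s) = u t)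
    (hβu : ∀ (s : Finset ι) (y : N.obj s), β s (u s) y = y) {n : ℤ} (g : SysCochain N n) :
    cup β 0 n n (fun σ => u σ.1) g = g := by
  funext σ
  rw [cup_apply]
  -- only the minimal vertex contributes
  have hmin : σ.1.Nonempty := σ.2.1
  set m : ι := σ.1.min' hmin with hm
  have hmmem : m ∈ σ.1 := Finset.min'_mem _ _
  rw [← Finset.add_sum_erase _ _ hmmem]
  have hrest : ∑ v ∈ σ.1.erase m, β σ.1 (SysCochain.ext0At (M := M) (n := 0) (fun τ => u τ.1) (σ.1.filter (· ≤ v)) σ.1)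
      (g.ext0At (σ.1.filter (v ≤ ·)) σ.1) = 0 := by
    refine Finset.sum_eq_zero fun v hv => ?_
    obtain ⟨hvm, hvs⟩ := Finset.mem_erase.1 hv
    -- `σ_{≤v}` has at least the two elements `m < v`, so it is not a `0`-simplex
    have hcard : ¬ (((σ.1.filter (· ≤ v)).card : ℤ) = 0 + 1) := by
      intro hc
      have h2 : 2 ≤ (σ.1.filter (· ≤ v)).card := by
        have hsub : ({m, v} : Finset ι) ⊆ σ.1.filter (· ≤ v) := by
          intro b hb
          simp only [Finset.mem_insert, Finset.mem_singleton] at hb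
          rcases hb with rfl | rfl
          · exact Finset.mem_filter.2 ⟨hmmem, Finset.min'_le _ _ hvs⟩
          · exact Finset.mem_filter.2 ⟨hvs, le_rfl⟩
        have := Finset.card_le_card hsub
        rwa [Finset.card_pair (Ne.symm hvm)] at this
      omega
    rw [ext0At_lowerCut_eq_zero _ σ.1 σ.1 v hcard, map_zero, LinearMap.zero_apply]
  rw [hrest, add_zero]
  -- at the minimal vertex: `σ_{≤m} = {m}`, `σ_{≥m} = σ`
  have hlow : σ.1.filter (· ≤ m) = {m} := by
    ext b
    simp only [Finset.mem_filter, Finset.mem_singleton]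
    constructor
    · rintro ⟨hb, hbm⟩
      exact le_antisymm hbm (Finset.min'_le _ _ hb)
    · rintro rfl
      exact ⟨hmmem, le_rfl⟩
  have hup : σ.1.filter (m ≤ ·) = σ.1 := by
    ext b
    simp only [Finset.mem_filter, and_iff_left_iff_imp]
    exact fun hb => Finset.min'_le _ _ hb
  have hval : SysCochain.ext0At (M := M) (n := 0) (fun τ => u τ.1) {m} σ.1 =
      (M.map (homOfLE (Finset.singleton_subset_iff.2 hmmem))).hom (u {m}) :=
    SysCochain.ext0At_val (M := M) (n := 0) (fun τ => u τ.1) (vertex m) σ.1 (Finset.singleton_subset_iff.2 hmmem)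
  rw [hlow, hup, SysCochain.ext0At_self, hval]
  exact (congrArg (fun x => β σ.1 x (g σ)) (hu _)).trans (hβu _ _)

/-- **Right unit**: for a pairing `β : N × M → N` with `β_s(y, u_s) = y` and a compatible family `u`:
`g ∪ u = g` on cochains. [cite: Godement1958, II §6.6] -/
theorem cup_unit {β : ∀ s : Finset ι, N.obj s →ₗ[A] M.obj s →ₗ[A] N.obj s} (u : ∀ s : Finset ι, M.obj s)
    (hu : ∀ ⦃s t : Finset ι⦄ (h : s ⊆ t), (M.map (homOfLE h)).hom (u s) = u t)
    (hβu : ∀ (s : Finset ι) (y : N.obj s), β s y (u s) = y) {n : ℤ} (g : SysCochain N n) :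
    cup β n 0 n g (fun σ => u σ.1) = g := by
  funext σ
  rw [cup_apply]
  -- only the maximal vertex contributes
  have hmax : σ.1.Nonempty := σ.2.1
  set m : ι := σ.1.max' hmax with hm
  have hmmem : m ∈ σ.1 := Finset.max'_mem _ _
  rw [← Finset.add_sum_erase _ _ hmmem]
  have hrest : ∑ v ∈ σ.1.erase m, β σ.1 (g.ext0At (σ.1.filter (· ≤ v)) σ.1)
      (SysCochain.ext0At (M := M) (n := 0) (fun τ => u τ.1) (σ.1.filter (v ≤ ·)) σ.1) = 0 := by
    refine Finset.sum_eq_zero fun v hv => ?_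
    obtain ⟨hvm, hvs⟩ := Finset.mem_erase.1 hv
    have hcard : ¬ (((σ.1.filter (v ≤ ·)).card : ℤ) = 0 + 1) := by
      intro hc
      have h2 : 2 ≤ (σ.1.filter (v ≤ ·)).card := by
        have hsub : ({v, m} : Finset ι) ⊆ σ.1.filter (v ≤ ·) := by
          intro b hb
          simp only [Finset.mem_insert, Finset.mem_singleton] at hb
          rcases hb with rfl | rfl
          · exact Finset.mem_filter.2 ⟨hvs, le_rfl⟩
          · exact Finset.mem_filter.2 ⟨hmmem, Finset.le_max' _ _ hvs⟩
        have := Finset.card_le_card hsub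
        rwa [Finset.card_pair hvm] at this
      omega
    rw [ext0At_upperCut_eq_zero _ σ.1 σ.1 v hcard, map_zero]
  rw [hrest, add_zero]
  have hup : σ.1.filter (m ≤ ·) = {m} := by
    ext b
    simp only [Finset.mem_filter, Finset.mem_singleton]
    constructor
    · rintro ⟨hb, hmb⟩
      exact le_antisymm (Finset.le_max' _ _ hb) hmb
    · rintro rfl
      exact ⟨hmmem, le_rfl⟩
  have hlow : σ.1.filter (· ≤ m) = σ.1 := by
    ext b
    simp only [Finset.mem_filter, and_iff_left_iff_imp]
    exact fun hb => Finset.le_max' _ _ hb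
  have hval : SysCochain.ext0At (M := M) (n := 0) (fun τ => u τ.1) {m} σ.1 =
      (M.map (homOfLE (Finset.singleton_subset_iff.2 hmmem))).hom (u {m}) :=
    SysCochain.ext0At_val (M := M) (n := 0) (fun τ => u τ.1) (vertex m) σ.1 (Finset.singleton_subset_iff.2 hmmem)
  rw [hlow, hup, SysCochain.ext0At_self, hval]
  exact (congrArg (fun x => β σ.1 (g σ) x) (hu _)).trans (hβu _ _)

end Unit

/-! ### Graded commutativity in bidegree `(1,1)` -/

section CommOneOne

variable {A : Type u} [CommRing A] {M P : Finset ι ⥤ ModuleCat.{v} A}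
  {μ : ∀ s : Finset ι, M.obj s →ₗ[A] M.obj s →ₗ[A] P.obj s}

/-- The `2`-simplex `{i < j < k}`. [folklore] [cite: GortzWedhorn2023, Def. 21.68 (p. 180)] -/
private theorem triple_card {i j k : ι} (hij : i < j) (hjk : j < k) : ({i, j, k} : Finset ι).card = 3 := by
  rw [Finset.card_insert_of_notMem, Finset.card_pair hjk.ne]
  simp only [Finset.mem_insert, Finset.mem_singleton, not_or]
  exact ⟨hij.ne, (hij.trans hjk).ne⟩

/-- Every `2`-simplex is `{i < j < k}`. [folklore] [cite: GortzWedhorn2023, Def. 21.68 (p. 180)] -/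
private theorem exists_eq_triple (σ : Simplex ι 2) :
    ∃ i j k : ι, ∃ (_ : i < j) (_ : j < k), σ.1 = {i, j, k} := by
  classical
  have hcard : σ.1.card = 3 := by have := σ.2.2; omega
  obtain ⟨i, j, k, hij, hik, hjk, hs⟩ := Finset.card_eq_three.1 hcard
  -- sort the three elements
  have key : ∀ a b c : ι, (∀ x, x ∈ ({a, b, c} : Finset ι) ↔ x ∈ ({i, j, k} : Finset ι)) →
      a < b → b < c → ∃ i j k : ι, ∃ (_ : i < j) (_ : j < k), σ.1 = {i, j, k} :=
    fun a b c h h1 h2 => ⟨a, b, c, h1, h2, hs.trans (Finset.ext fun x => (h x).symm)⟩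
  have mem3 : ∀ a b c x : ι, x ∈ ({a, b, c} : Finset ι) ↔ x = a ∨ x = b ∨ x = c := fun a b c x => by
    simp only [Finset.mem_insert, Finset.mem_singleton]
  rcases lt_trichotomy i j with h1 | h1 | h1
  · rcases lt_trichotomy j k with h2 | h2 | h2
    · exact key i j k (fun x => Iff.rfl) h1 h2
    · exact absurd h2 hjk
    · rcases lt_trichotomy i k with h3 | h3 | h3
      · exact key i k j (fun x => by rw [mem3, mem3]; tauto) h3 h2
      · exact absurd h3 hik
      · exact key k i j (fun x => by rw [mem3, mem3]; tauto) h3 h1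
  · exact absurd h1 hij
  · rcases lt_trichotomy i k with h3 | h3 | h3
    · exact key j i k (fun x => by rw [mem3, mem3]; tauto) h1 h3
    · exact absurd h3 hik
    · rcases lt_trichotomy j k with h2 | h2 | h2
      · exact key j k i (fun x => by rw [mem3, mem3]; tauto) h2 h3
      · exact absurd h2 hjk
      · exact key k j i (fun x => by rw [mem3, mem3]; tauto) h2 h1

variable (μ) in
/-- **The cup product of two `1`-cochains on the `2`-simplex `{i < j < k}`**:
`(a ∪ b)_{ijk} = μ(a.ext0At {i,j} σ, b.ext0At {j,k} σ)`. [cite: Godement1958, II §6.6] -/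
theorem cup_one_one_apply_triple (a b : SysCochain M 1) (σ : Simplex ι 2) {i j k : ι} (hij : i < j) (hjk : j < k)
    (hσ : σ.1 = {i, j, k}) :
    cup μ 1 1 2 a b σ = μ σ.1 (a.ext0At {i, j} σ.1) (b.ext0At {j, k} σ.1) := by
  have hik : i < k := hij.trans hjk
  rw [cup_apply, hσ, Finset.sum_insert, Finset.sum_pair hjk.ne]
  rotate_left
  · simp only [Finset.mem_insert, Finset.mem_singleton, not_or]; exact ⟨hij.ne, hik.ne⟩
  -- the cuts
  have li : ({i, j, k} : Finset ι).filter (· ≤ i) = {i} := by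
    ext b; simp only [Finset.mem_filter, Finset.mem_insert, Finset.mem_singleton]
    constructor
    · rintro ⟨rfl | rfl | rfl, hb⟩
      · rfl
      · exact absurd hb (not_le.2 hij)
      · exact absurd hb (not_le.2 hik)
    · rintro rfl; exact ⟨Or.inl rfl, le_rfl⟩
  have lj : ({i, j, k} : Finset ι).filter (· ≤ j) = {i, j} := by
    ext b; simp only [Finset.mem_filter, Finset.mem_insert, Finset.mem_singleton]
    constructor
    · rintro ⟨rfl | rfl | rfl, hb⟩
      · exact Or.inl rfl
      · exact Or.inr rfl
      · exact absurd hb (not_le.2 hjk)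
    · rintro (rfl | rfl)
      · exact ⟨Or.inl rfl, le_of_lt hij⟩
      · exact ⟨Or.inr (Or.inl rfl), le_rfl⟩
  have uj : ({i, j, k} : Finset ι).filter (j ≤ ·) = {j, k} := by
    ext b; simp only [Finset.mem_filter, Finset.mem_insert, Finset.mem_singleton]
    constructor
    · rintro ⟨rfl | rfl | rfl, hb⟩
      · exact absurd hb (not_le.2 hij)
      · exact Or.inl rfl
      · exact Or.inr rfl
    · rintro (rfl | rfl)
      · exact ⟨Or.inr (Or.inl rfl), le_rfl⟩
      · exact ⟨Or.inr (Or.inr rfl), le_of_lt hjk⟩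
  have uk : ({i, j, k} : Finset ι).filter (k ≤ ·) = {k} := by
    ext b; simp only [Finset.mem_filter, Finset.mem_insert, Finset.mem_singleton]
    constructor
    · rintro ⟨rfl | rfl | rfl, hb⟩
      · exact absurd hb (not_le.2 hik)
      · exact absurd hb (not_le.2 hjk)
      · rfl
    · rintro rfl; exact ⟨Or.inr (Or.inr rfl), le_rfl⟩
  -- the end terms vanish: `{i}` and `{k}` are not `1`-simplices
  have hi0 : a.ext0At (({i, j, k} : Finset ι).filter (· ≤ i)) {i, j, k} = 0 := by
    apply ext0At_lowerCut_eq_zero; rw [li, Finset.card_singleton]; omega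
  have hk0 : b.ext0At (({i, j, k} : Finset ι).filter (k ≤ ·)) {i, j, k} = 0 := by
    apply ext0At_upperCut_eq_zero; rw [uk, Finset.card_singleton]; omega
  rw [hi0, map_zero, LinearMap.zero_apply, zero_add, hk0, map_zero, add_zero, lj, uj, ← hσ]

/-- **The differential of a `1`-cochain on `{i < j < k}`**: `(d c)_{ijk} = c.ext0At {j,k} − c.ext0At {i,k} + c.ext0At {i,j}`
(all pushed to `σ`). [cite: GortzWedhorn2023, Def. 21.68 (p. 180)] -/
theorem sysD_one_apply_triple (c : SysCochain P 1) (σ : Simplex ι 2) {i j k : ι} (hij : i < j) (hjk : j < k)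
    (hσ : σ.1 = {i, j, k}) :
    sysD P 1 c σ = c.ext0At {j, k} σ.1 - c.ext0At {i, k} σ.1 + c.ext0At {i, j} σ.1 := by
  have hik : i < k := hij.trans hjk
  rw [sysD_apply, hσ, Finset.sum_insert, Finset.sum_pair hjk.ne]
  rotate_left
  · simp only [Finset.mem_insert, Finset.mem_singleton, not_or]; exact ⟨hij.ne, hik.ne⟩
  -- erasures
  have ei : ({i, j, k} : Finset ι).erase i = {j, k} := by
    rw [Finset.erase_insert]
    simp only [Finset.mem_insert, Finset.mem_singleton, not_or]; exact ⟨hij.ne, hik.ne⟩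
  have ej : ({i, j, k} : Finset ι).erase j = {i, k} := by
    ext b; simp only [Finset.mem_erase, Finset.mem_insert, Finset.mem_singleton]
    constructor
    · rintro ⟨hb, rfl | rfl | rfl⟩
      · exact Or.inl rfl
      · exact absurd rfl hb
      · exact Or.inr rfl
    · rintro (rfl | rfl)
      · exact ⟨hij.ne, Or.inl rfl⟩
      · exact ⟨hjk.ne', Or.inr (Or.inr rfl)⟩
  have ek : ({i, j, k} : Finset ι).erase k = {i, j} := by
    ext b; simp only [Finset.mem_erase, Finset.mem_insert, Finset.mem_singleton]
    constructor
    · rintro ⟨hb, rfl | rfl | rfl⟩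
      · exact Or.inl rfl
      · exact Or.inr rfl
      · exact absurd rfl hb
    · rintro (rfl | rfl)
      · exact ⟨hik.ne, Or.inl rfl⟩
      · exact ⟨hjk.ne, Or.inr (Or.inl rfl)⟩
  -- signs
  have si : sign A ({i, j, k} : Finset ι) i = 1 := by
    unfold sign
    rw [show ({i, j, k} : Finset ι).filter (· < i) = ∅ from ?_, Finset.card_empty, pow_zero]
    ext b; simp only [Finset.mem_filter, Finset.mem_insert, Finset.mem_singleton, Finset.notMem_empty, iff_false,
      not_and]
    rintro (rfl | rfl | rfl)
    · exact lt_irrefl _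
    · exact lt_asymm hij
    · exact lt_asymm hik
  have sj : sign A ({i, j, k} : Finset ι) j = -1 := by
    unfold sign
    rw [show ({i, j, k} : Finset ι).filter (· < j) = {i} from ?_, Finset.card_singleton, pow_one]
    ext b; simp only [Finset.mem_filter, Finset.mem_insert, Finset.mem_singleton]
    constructor
    · rintro ⟨rfl | rfl | rfl, hb⟩
      · rfl
      · exact absurd hb (lt_irrefl _)
      · exact absurd hb (lt_asymm hjk)
    · rintro rfl; exact ⟨Or.inl rfl, hij⟩
  have sk : sign A ({i, j, k} : Finset ι) k = 1 := by
    unfold sign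
    rw [show ({i, j, k} : Finset ι).filter (· < k) = {i, j} from ?_, Finset.card_pair hij.ne]
    · norm_num
    ext b; simp only [Finset.mem_filter, Finset.mem_insert, Finset.mem_singleton]
    constructor
    · rintro ⟨rfl | rfl | rfl, hb⟩
      · exact Or.inl rfl
      · exact Or.inr rfl
      · exact absurd hb (lt_irrefl _)
    · rintro (rfl | rfl)
      · exact ⟨Or.inl rfl, hik⟩
      · exact ⟨Or.inr (Or.inl rfl), hjk⟩
  rw [ei, ej, ek, si, sj, sk, one_smul, neg_one_smul, one_smul, ← hσ]
  abel

/-- **Graded commutativity in bidegree `(1,1)`**: for a COMMUTATIVE natural pairing `μ : M × M → P`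
(`μ(x,y) = μ(y,x)`) and two `1`-COCYCLES `a`, `b`:  `a ∪ b + b ∪ a = − d (a ⋆ b)`, where `(a ⋆ b)_e := μ(a_e, b_e)` is the
pointwise product `1`-cochain — hence `[a] ∪ [b] = −[b] ∪ [a]` on cohomology.  (On `{i<j<k}`: `(a∪b + b∪a)_{ijk} =
μ(a_{ij},b_{jk}) + μ(a_{jk},b_{ij})`, and the cocycle conditions `a_{ik} = a_{ij} + a_{jk}`, `b_{ik} = b_{ij} + b_{jk}` give
`(d(a⋆b))_{ijk} = μ(a_{jk},b_{jk}) − μ(a_{ik},b_{ik}) + μ(a_{ij},b_{ij}) = −μ(a_{ij},b_{jk}) − μ(a_{jk},b_{ij})`.)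
[cite: Godement1958, II §6.6] [cite: GortzWedhorn2023, (21.29)] -/
theorem cup_add_cup_swap_eq_neg_sysD (hμ : IsNaturalPairing μ)
    (hcomm : ∀ (s : Finset ι) (x y : M.obj s), μ s x y = μ s y x)
    {a b : SysCochain M 1} (ha : sysD M 1 a = 0) (hb : sysD M 1 b = 0) :
    cup μ 1 1 2 a b + cup μ 1 1 2 b a = -sysD P 1 (fun e => μ e.1 (a e) (b e)) := by
  funext σ
  obtain ⟨i, j, k, hij, hjk, hσ⟩ := exists_eq_triple σ
  have hik : i < k := hij.trans hjk
  change cup μ 1 1 2 a b σ + cup μ 1 1 2 b a σ = -(sysD P 1 (fun e => μ e.1 (a e) (b e)) σ)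
  rw [cup_one_one_apply_triple μ a b σ hij hjk hσ, cup_one_one_apply_triple μ b a σ hij hjk hσ,
    sysD_one_apply_triple _ σ hij hjk hσ]
  -- the simplex as a finite set
  set S : Finset ι := σ.1 with hS
  -- `ext0At` of the pointwise product is the product of the `ext0At`s (naturality of `μ`)
  have hprod : ∀ {x y : ι} (hxy : x < y),
      SysCochain.ext0At (M := P) (n := 1) (fun e => μ e.1 (a e) (b e)) {x, y} S =
        μ S (a.ext0At {x, y} S) (b.ext0At {x, y} S) := by
    intro x y hxy
    by_cases hxS : ({x, y} : Finset ι) ⊆ S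
    · have e1 : SysCochain.ext0At (M := P) (n := 1) (fun e => μ e.1 (a e) (b e)) {x, y} S =
          (P.map (homOfLE hxS)).hom (μ {x, y} (a (edge x y hxy)) (b (edge x y hxy))) :=
        SysCochain.ext0At_val (M := P) (n := 1) (fun e => μ e.1 (a e) (b e)) (edge x y hxy) S hxS
      have e2 : a.ext0At {x, y} S = (M.map (homOfLE hxS)).hom (a (edge x y hxy)) :=
        SysCochain.ext0At_val a (edge x y hxy) S hxS
      have e3 : b.ext0At {x, y} S = (M.map (homOfLE hxS)).hom (b (edge x y hxy)) :=
        SysCochain.ext0At_val b (edge x y hxy) S hxS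
      rw [e1, e2, e3]
      exact hμ hxS _ _
    · have h0 : ∀ {Q : Finset ι ⥤ ModuleCat.{v} A} (c : SysCochain Q 1), c.ext0At {x, y} S = 0 := by
        intro Q c
        unfold SysCochain.ext0At
        rw [dif_neg]
        exact fun h => hxS h.2
      simp only [h0, map_zero]
  rw [hprod hjk, hprod hik, hprod hij]
  -- the cocycle conditions on `σ`: `c.ext0At {i,k} = c.ext0At {i,j} + c.ext0At {j,k}`
  have hcoc : ∀ {c : SysCochain M 1}, sysD M 1 c = 0 → c.ext0At {i, k} S = c.ext0At {i, j} S + c.ext0At {j, k} S := by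
    intro c hc
    have h := sysD_one_apply_triple c σ hij hjk hσ
    rw [hc] at h
    change (0 : M.obj S) = _ at h
    rw [← sub_eq_zero]
    rw [show c.ext0At {i, k} S - (c.ext0At {i, j} S + c.ext0At {j, k} S) =
      -(c.ext0At {j, k} S - c.ext0At {i, k} S + c.ext0At {i, j} S) by abel, ← h, neg_zero]
  rw [hcoc ha, hcoc hb, map_add, map_add, LinearMap.add_apply, LinearMap.add_apply, hcomm S (b.ext0At {i, j} S)]
  abel

end CommOneOne

end OrderedCech

end Literature.Algebra.Homology

end
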